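import Summits.ValiantsHypothesis.ValiantsHypothesis.Theorems.VPBoundarySquareCHAlgebraicHalf
import HarnessLib

/-!
# VP-boundary square — the Q-side: restricted splits and the boundary dichotomy

Route `VPBoundarySquare` decides `VP ℂ ≠ VNP ℂ` from the pair
`Q := EmptyBoundarySeparates` (`∂VP = ∅ → VNP ⊄ closure(VP)`) and
`P := CollapseEmptiesBoundary` (`VP = VNP → ∂VP = ∅`), all on p-families in the variables
`Fin (v n)`.  This file records the **one-parameter family of such splits** obtained by asking the
empty-boundary statements only of a TEST CLASS `D` of p-families:

* `BoundaryEmptyOn D`          — every `D`-family with p-bounded border complexity is p-computable;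
* `EmptyBoundarySeparatesOn D`  — `Q_D := BoundaryEmptyOn D → ¬ VNPSubsetVPBar`;
* `CollapseEmptiesBoundaryOn D` — `P_D := VP ℂ = VNP ℂ → BoundaryEmptyOn D`;
* `BoundaryPointIn D`           — `M_D`: a `D`-family in `closure(VP) ∖ VP`.

For every `D` the pair still decides the summit (`valiant_of_on`), `Q_D` is monotone and `P_D`
antitone in `D`, and the route is the endpoint `D = all` (`emptyBoundarySeparates_iff_on_univ`,
`collapseEmptiesBoundary_iff_on_univ`).  At the other endpoint `D = VNP` the collapse side is
TRIVIAL (`collapseEmptiesBoundaryOn_vnp`) and `Q_VNP` IS Valiant's hypothesis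
(`valiant_iff_emptyBoundarySeparatesOn_vnp`); whenever `VNP ⊆ D` the split is exact
(`valiant_iff_on`).  The definability coordinate of the route (`U_CH`) enters at the test class
`D = CH-chartable families` (`IsCHChartable`: a `VCH⁰`-specialisation presentation): there the
collapse side is a THEOREM modulo GRH (`collapseEmptiesBoundaryOn_ch_of_ERH`, the landed
`pCH_of_ERH`), and `VNP ⊆ D` holds modulo Bürgisser's `VNPnb⁰ ⊆ VCH⁰` (`Bur26_cor_4_10`), so

  **`ValiantsHypothesis ↔ Q_CH ↔ (VNP ⊄ closure(VP)) ∨ (∂VP contains a CH-chartable p-family)`**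

(`valiant_iff_emptyBoundarySeparatesOn_ch`, `valiant_iff_borderValiant_or_chBoundaryPoint`, modulo
`ERH` and `Bur26_cor_4_10`; with the test class `VNP ∪ CH-chartable` modulo `ERH` alone:
`valiant_iff_emptyBoundarySeparatesOn_vnpOrCh`, `valiant_iff_borderValiant_or_vnpOrChBoundaryPoint`).  In words: Valiant's hypothesis is exactly the dichotomy «its border
version holds, or the boundary of `VP` has a point definable in the counting hierarchy»; the route's
residual pair `(Q, U_CH)` implies the right-hand side outright
(`borderValiant_or_chBoundaryPoint_of_Q_of_U`) and over-asks precisely by demanding CH-charts for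
ALL of the boundary instead of ONE boundary point.  Single-witness form:
`valiant_of_ERH_of_chWitness` (a CH-chartable p-family that is not p-computable proves
`VP ≠ VNP` under GRH — border complexity not even needed), the `CH` twin of the landed
`valiant_of_ERH_of_nbWitness`.

References: Bürgisser 2026 (HNC) Cor. 4.10, Cor. 4.12; Grochow–Mulmuley–Qiao 2016 (the question
`closure(VP) = VP?`, `GrochowMulmuleyQiao2016`, §1); Bürgisser 2000, Cor. 1.2 (GRH elimination of constants).
-/

noncomputable section

set_option linter.dupNamespace false

open Literature.Computability.AlgebraicComplexity Literature.Computability.Complexity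
open Literature.NumberTheory.LFunctions (ExtendedRiemannHypothesis)

open Summit.ValiantsHypothesis.ValiantsHypothesis.Theses.VPBoundarySquare
open Summit.ValiantsHypothesis.ValiantsHypothesis.Theorems.VPBoundarySquareCompletionLadder
open Summit.ValiantsHypothesis.ValiantsHypothesis.Theorems.VPBoundarySquareCHAlgebraicHalf

namespace Summit.ValiantsHypothesis.ValiantsHypothesis.Theorems.VPBoundarySquareBoundaryDichotomy

/-! ### The statements, relative to a test class `D` of p-families -/

/-- **`B`: `VNP ⊆ closure(VP)` on p-families** — the negation of the border form of Valiant's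
hypothesis; verbatim the statement negated in the conclusion of the route item
`EmptyBoundarySeparates` (a local abbreviation of this file, not a literature fact). -/
def VNPSubsetVPBar : Prop :=
  ∀ (v : ℕ → ℕ) (f : ∀ n, MvPolynomial (Fin (v n)) ℂ), IsVNPFamily f → IsVPBarFamily f

/-- **CH-chartable p-family**: `f` is the specialisation, at polynomially many complex constants, of
an integer family in `VCH⁰` (exponential format, coefficient function in `CH/poly`) — the
presentation asked of every `closure(VP)` family by the route's `CHClosureDefinable`.
[cite: Burgisser2026HNC, Def. 4.1-4.2 (p. 11)] -/
def IsCHChartable {v : ℕ → ℕ} (f : ∀ n, MvPolynomial (Fin (v n)) ℂ) : Prop :=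
  ∃ (w : ℕ → ℕ) (Q : ∀ n, MvPolynomial (Fin (v n + w n)) ℤ) (κ : ∀ n, Fin (w n) → ℂ),
    IsVCH0Family Q ∧ ∀ n, f n = MvPolynomial.aeval
      (Fin.append MvPolynomial.X fun j => MvPolynomial.C (κ n j))
      (MvPolynomial.map (Int.castRingHom ℂ) (Q n))

/-- **`A_D`: the boundary of `VP` is empty on the test class `D`** — every `D`-p-family with
p-bounded border complexity is p-computable. [cite: BurgisserEtAl2011, §9.3 (closure of VP)] -/
def BoundaryEmptyOn (D : ∀ v : ℕ → ℕ, (∀ n, MvPolynomial (Fin (v n)) ℂ) → Prop) : Prop :=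
  ∀ (v : ℕ → ℕ) (f : ∀ n, MvPolynomial (Fin (v n)) ℂ), IsPFamily f → D v f → IsVPBarFamily f →
    IsPComputable f

/-- **`Q_D`**: if the boundary of `VP` is empty on `D`, then `VNP ⊄ closure(VP)`. [folklore] -/
def EmptyBoundarySeparatesOn (D : ∀ v : ℕ → ℕ, (∀ n, MvPolynomial (Fin (v n)) ℂ) → Prop) : Prop :=
  BoundaryEmptyOn D → ¬ VNPSubsetVPBar

/-- **`P_D`**: the collapse `VP = VNP` empties the boundary of `VP` on `D`. [folklore] -/
def CollapseEmptiesBoundaryOn (D : ∀ v : ℕ → ℕ, (∀ n, MvPolynomial (Fin (v n)) ℂ) → Prop) : Prop :=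
  VP ℂ = VNP ℂ → BoundaryEmptyOn D

/-- **`M_D`: a boundary point of `VP` in the class `D`** — a `D`-p-family with p-bounded border
complexity that is not p-computable. [cite: BurgisserEtAl2011, §9.3 (closure of VP)] -/
def BoundaryPointIn (D : ∀ v : ℕ → ℕ, (∀ n, MvPolynomial (Fin (v n)) ℂ) → Prop) : Prop :=
  ∃ (v : ℕ → ℕ) (f : ∀ n, MvPolynomial (Fin (v n)) ℂ),
    IsPFamily f ∧ D v f ∧ IsVPBarFamily f ∧ ¬ IsPComputable f

variable {D D' : ∀ v : ℕ → ℕ, (∀ n, MvPolynomial (Fin (v n)) ℂ) → Prop}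

/-! ### Logic of the restricted split -/

/-- `A_D ↔ ¬ M_D`. [folklore] -/
theorem boundaryEmptyOn_iff_not_boundaryPointIn (D : ∀ v : ℕ → ℕ, (∀ n, MvPolynomial (Fin (v n)) ℂ) → Prop) :
    BoundaryEmptyOn D ↔ ¬ BoundaryPointIn D := by
  simp only [BoundaryEmptyOn, BoundaryPointIn, not_exists, not_and, not_not]

/-- `Q_D ↔ (VNP ⊄ closure(VP)) ∨ M_D`. [folklore] -/
theorem emptyBoundarySeparatesOn_iff (D : ∀ v : ℕ → ℕ, (∀ n, MvPolynomial (Fin (v n)) ℂ) → Prop) :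
    EmptyBoundarySeparatesOn D ↔ (¬ VNPSubsetVPBar ∨ BoundaryPointIn D) := by
  rw [EmptyBoundarySeparatesOn, boundaryEmptyOn_iff_not_boundaryPointIn]
  tauto

/-- **`VNP ⊄ closure(VP)` separates** (no hypothesis): under `VP = VNP` every VNP p-family is
p-computable, hence has p-bounded border complexity. [cite: BurgisserEtAl2011, §9.3 (closure of VP)] -/
theorem valiant_of_not_vnpSubsetVPBar (h : ¬ VNPSubsetVPBar) : ValiantsHypothesis := by
  intro hEq
  refine h fun v f hf => ?_
  have hVP : (⟨v, f⟩ : PolyFamily ℂ) ∈ VP ℂ := by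
    rw [hEq]; exact hf
  exact hVP.2.mono fun n => approxComplexity_le_complexity (f n)

/-- **The restricted pair decides the summit, for every test class `D`** (the route's `closes` is
the case `D = all`). [folklore] -/
theorem valiant_of_on (D : ∀ v : ℕ → ℕ, (∀ n, MvPolynomial (Fin (v n)) ℂ) → Prop)
    (hQ : EmptyBoundarySeparatesOn D) (hP : CollapseEmptiesBoundaryOn D) : ValiantsHypothesis :=
  fun hEq => valiant_of_not_vnpSubsetVPBar (hQ (hP hEq)) hEq

/-- `A` is antitone in the test class. [folklore] -/
theorem boundaryEmptyOn_anti (h : ∀ v f, D v f → D' v f) (hA : BoundaryEmptyOn D') :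
    BoundaryEmptyOn D :=
  fun v f hpf hD hbar => hA v f hpf (h v f hD) hbar

/-- `Q_D` is monotone in the test class (smaller class = stronger statement). [folklore] -/
theorem emptyBoundarySeparatesOn_mono (h : ∀ v f, D v f → D' v f)
    (hQ : EmptyBoundarySeparatesOn D) : EmptyBoundarySeparatesOn D' :=
  fun hA => hQ (boundaryEmptyOn_anti h hA)

/-- `P_D` is antitone in the test class (smaller class = weaker statement). [folklore] -/
theorem collapseEmptiesBoundaryOn_anti (h : ∀ v f, D v f → D' v f)
    (hP : CollapseEmptiesBoundaryOn D') : CollapseEmptiesBoundaryOn D :=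
  fun hEq => boundaryEmptyOn_anti h (hP hEq)

/-- `M_D` is monotone in the test class. [folklore] -/
theorem boundaryPointIn_mono (h : ∀ v f, D v f → D' v f) (hM : BoundaryPointIn D) :
    BoundaryPointIn D' := by
  obtain ⟨v, f, hpf, hD, hbar, hnc⟩ := hM
  exact ⟨v, f, hpf, h v f hD, hbar, hnc⟩

/-! ### The endpoint `D = all`: the route's items -/

/-- `Q = Q_all`. [folklore] -/
theorem emptyBoundarySeparates_iff_on_univ :
    EmptyBoundarySeparates ↔ EmptyBoundarySeparatesOn fun _ _ => True :=
  ⟨fun h hA => h fun v f hpf hbar => hA v f hpf trivial hbar,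
    fun h hA => h fun v f hpf _ hbar => hA v f hpf hbar⟩

/-- `P = P_all`. [folklore] -/
theorem collapseEmptiesBoundary_iff_on_univ :
    CollapseEmptiesBoundary ↔ CollapseEmptiesBoundaryOn fun _ _ => True :=
  ⟨fun h hEq v f hpf _ hbar => h hEq v f hpf hbar, fun h hEq v f hpf hbar => h hEq v f hpf trivial hbar⟩

/-- `M = M_all` (`BoundaryOfVPNonempty`, the [GCT5] conjecture studied by Grochow–Mulmuley–Qiao).
[cite: GrochowMulmuleyQiao2016, §1] -/
theorem boundaryOfVPNonempty_iff_on_univ :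
    BoundaryOfVPNonempty ↔ BoundaryPointIn fun _ _ => True := by
  rw [← not_iff_not, ← boundaryEmptyOn_iff_not_boundaryPointIn]
  simp only [BoundaryOfVPNonempty, not_not, BoundaryEmptyOn]
  exact ⟨fun h v f hpf _ hbar => h v f hpf hbar, fun h v f hpf hbar => h v f hpf trivial hbar⟩

/-! ### The endpoint `D = VNP`: the collapse side is trivial, the separation side is the summit -/

/-- **`P_VNP` holds outright.** [folklore] -/
theorem collapseEmptiesBoundaryOn_vnp : CollapseEmptiesBoundaryOn fun _ f => IsVNPFamily f := by
  intro hEq v f _ hf _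
  have hVP : (⟨v, f⟩ : PolyFamily ℂ) ∈ VP ℂ := by
    rw [hEq]; exact hf
  exact hVP.2

/-- **`S ⟹ Q_D` whenever `VNP ⊆ D`.** [cite: BurgisserClausenShokrollahi1997, §21.5 p. 561] -/
theorem emptyBoundarySeparatesOn_of_valiant (hD : ∀ v f, IsVNPFamily f → D v f)
    (hS : ValiantsHypothesis) : EmptyBoundarySeparatesOn D := by
  intro hA hB
  obtain ⟨F, hFVNP, hFVP⟩ : ∃ F, F ∈ VNP ℂ ∧ F ∉ VP ℂ := by
    by_contra h
    push Not at h
    exact hS (Set.Subset.antisymm (VP_subset_VNP_holds ℂ) h)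
  exact hFVP ⟨hFVNP.1, hA F.nvars F.poly hFVNP.1 (hD _ _ hFVNP) (hB _ _ hFVNP)⟩

/-- **`S ⟹ P_D`** (trivially: the hypothesis of `P_D` is `¬ S`). [folklore] -/
theorem collapseEmptiesBoundaryOn_of_valiant (hS : ValiantsHypothesis) : CollapseEmptiesBoundaryOn D :=
  fun hEq => absurd hEq hS

/-- **The split is exact on every test class containing `VNP`:** `S ↔ Q_D ∧ P_D`.
[cite: BurgisserClausenShokrollahi1997, §21.5 p. 561] -/
theorem valiant_iff_on (hD : ∀ v f, IsVNPFamily f → D v f) :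
    ValiantsHypothesis ↔ EmptyBoundarySeparatesOn D ∧ CollapseEmptiesBoundaryOn D :=
  ⟨fun hS => ⟨emptyBoundarySeparatesOn_of_valiant hD hS, collapseEmptiesBoundaryOn_of_valiant hS⟩,
    fun h => valiant_of_on D h.1 h.2⟩

/-- **`Q_VNP` is Valiant's hypothesis.** [cite: BurgisserClausenShokrollahi1997, §21.5 p. 561] -/
theorem valiant_iff_emptyBoundarySeparatesOn_vnp :
    ValiantsHypothesis ↔ EmptyBoundarySeparatesOn fun _ f => IsVNPFamily f :=
  ⟨emptyBoundarySeparatesOn_of_valiant fun _ _ h => h,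
    fun hQ => valiant_of_on _ hQ collapseEmptiesBoundaryOn_vnp⟩

/-! ### The point `D = CH-chartable`: the collapse side is a theorem modulo GRH -/

/-- **`P_CH` modulo GRH** — the landed `pCH_of_ERH` read as the collapse side of the restricted
split at the CH-chartable test class (border complexity is not even used).
[cite: Burgisser2026HNC, Cor. 4.12 (p. 14)] [cite: Burgisser2000, Cor. 1.2] -/
theorem collapseEmptiesBoundaryOn_ch_of_ERH (hGRH : ExtendedRiemannHypothesis) :
    CollapseEmptiesBoundaryOn fun _ f => IsCHChartable f :=
  fun hEq v f hpf hch _ => pCH_of_ERH hGRH hEq v f hpf hch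

/-- **`VNP ⊆ CH-chartable`** (modulo `Bur26_cor_4_10 : VNPnb⁰ ⊆ VCH⁰`), via `VNP ⊆ VNPnb` and the
landed `vchSpec_of_isVNPnbFamily`. [cite: Burgisser2026HNC, Cor. 4.10 (p. 13)] -/
theorem isCHChartable_of_isVNPFamily (h410 : Bur26_cor_4_10) {v : ℕ → ℕ}
    {f : ∀ n, MvPolynomial (Fin (v n)) ℂ} (hf : IsVNPFamily f) : IsCHChartable f :=
  vchSpec_of_isVNPnbFamily h410 (hf.1.1.mono fun n => by simp) hf.isVNPnbFamily

/-- **`S ↔ Q_CH`** (modulo GRH and `Bur26_cor_4_10`): Valiant's hypothesis is EXACTLY «if every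
CH-chartable p-family with p-bounded border complexity is p-computable, then `VNP ⊄ closure(VP)`».
[cite: Burgisser2026HNC, Cor. 4.10, Cor. 4.12 (pp. 13-14)] -/
theorem valiant_iff_emptyBoundarySeparatesOn_ch (hGRH : ExtendedRiemannHypothesis)
    (h410 : Bur26_cor_4_10) :
    ValiantsHypothesis ↔ EmptyBoundarySeparatesOn fun _ f => IsCHChartable f :=
  ⟨emptyBoundarySeparatesOn_of_valiant fun _ _ hf => isCHChartable_of_isVNPFamily h410 hf,
    fun hQ => valiant_of_on _ hQ (collapseEmptiesBoundaryOn_ch_of_ERH hGRH)⟩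

/-- **THE BOUNDARY DICHOTOMY** (modulo GRH and `Bur26_cor_4_10`):
`VP ℂ ≠ VNP ℂ  ↔  (VNP ⊄ closure(VP) on p-families)  ∨  (∂VP contains a CH-chartable p-family)`.
[cite: Burgisser2026HNC, Cor. 4.10, Cor. 4.12 (pp. 13-14)] [cite: GrochowMulmuleyQiao2016, §1] -/
theorem valiant_iff_borderValiant_or_chBoundaryPoint (hGRH : ExtendedRiemannHypothesis)
    (h410 : Bur26_cor_4_10) :
    ValiantsHypothesis ↔ (¬ VNPSubsetVPBar ∨ BoundaryPointIn fun _ f => IsCHChartable f) := by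
  rw [valiant_iff_emptyBoundarySeparatesOn_ch hGRH h410, emptyBoundarySeparatesOn_iff]

/-- **Single CH-witness form** (the `CH` twin of `valiant_of_ERH_of_nbWitness`): ONE CH-chartable
p-family that is not p-computable proves `VP ℂ ≠ VNP ℂ` under GRH; its border complexity plays no
role. [cite: Burgisser2026HNC, Cor. 4.12 (p. 14)] [cite: Burgisser2000, Cor. 1.2] -/
theorem valiant_of_ERH_of_chWitness (hGRH : ExtendedRiemannHypothesis) {v : ℕ → ℕ}
    {f : ∀ n, MvPolynomial (Fin (v n)) ℂ} (hpf : IsPFamily f) (hch : IsCHChartable f)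
    (hnc : ¬ IsPComputable f) : ValiantsHypothesis :=
  fun hEq => hnc (pCH_of_ERH hGRH hEq v f hpf hch)

/-- A CH-chartable boundary point of `VP` separates (modulo GRH). [cite: Burgisser2026HNC, Cor. 4.12 (p. 14)] -/
theorem valiant_of_ERH_of_chBoundaryPoint (hGRH : ExtendedRiemannHypothesis)
    (h : BoundaryPointIn fun _ f => IsCHChartable f) : ValiantsHypothesis := by
  obtain ⟨v, f, hpf, hch, -, hnc⟩ := h
  exact valiant_of_ERH_of_chWitness hGRH hpf hch hnc

/-! ### The point `D = VNP ∪ CH-chartable`: the same, with GRH as the only named input -/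

/-- **`P_{VNP ∪ CH}` modulo GRH**: VNP families are p-computable under the collapse outright,
CH-chartable ones by `pCH_of_ERH`. [cite: Burgisser2026HNC, Cor. 4.12 (p. 14)] [cite: Burgisser2000, Cor. 1.2] -/
theorem collapseEmptiesBoundaryOn_vnpOrCh_of_ERH (hGRH : ExtendedRiemannHypothesis) :
    CollapseEmptiesBoundaryOn fun _ f => IsVNPFamily f ∨ IsCHChartable f := by
  intro hEq v f hpf hD hbar
  rcases hD with hf | hch
  · exact collapseEmptiesBoundaryOn_vnp hEq v f hpf hf hbar
  · exact pCH_of_ERH hGRH hEq v f hpf hch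

/-- **`S ↔ Q_{VNP ∪ CH}` modulo GRH alone** (no `Bur26_cor_4_10`): Valiant's hypothesis is exactly
«if every p-family with p-bounded border complexity that is p-definable OR CH-chartable is
p-computable, then `VNP ⊄ closure(VP)`». [cite: Burgisser2026HNC, Cor. 4.12 (p. 14)] [cite: Burgisser2000, Cor. 1.2] -/
theorem valiant_iff_emptyBoundarySeparatesOn_vnpOrCh (hGRH : ExtendedRiemannHypothesis) :
    ValiantsHypothesis ↔ EmptyBoundarySeparatesOn fun _ f => IsVNPFamily f ∨ IsCHChartable f :=
  ⟨emptyBoundarySeparatesOn_of_valiant fun _ _ hf => Or.inl hf,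
    fun hQ => valiant_of_on _ hQ (collapseEmptiesBoundaryOn_vnpOrCh_of_ERH hGRH)⟩

/-- **The dichotomy modulo GRH alone**: `VP ℂ ≠ VNP ℂ ↔ (VNP ⊄ closure(VP)) ∨ (∂VP contains a
p-family that is p-definable or CH-chartable)`. [cite: Burgisser2026HNC, Cor. 4.12 (p. 14)] [cite: GrochowMulmuleyQiao2016, §1] -/
theorem valiant_iff_borderValiant_or_vnpOrChBoundaryPoint (hGRH : ExtendedRiemannHypothesis) :
    ValiantsHypothesis ↔
      (¬ VNPSubsetVPBar ∨ BoundaryPointIn fun _ f => IsVNPFamily f ∨ IsCHChartable f) := by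
  rw [valiant_iff_emptyBoundarySeparatesOn_vnpOrCh hGRH, emptyBoundarySeparatesOn_iff]

/-- Unconditionally, a p-DEFINABLE boundary point of `VP` is Valiant's hypothesis itself
(`M_VNP → S`; the converse holds whenever `VNP ⊆ closure(VP)`). [cite: BurgisserClausenShokrollahi1997, §21.5 p. 561] -/
theorem valiant_of_vnpBoundaryPoint (h : BoundaryPointIn fun _ f => IsVNPFamily f) :
    ValiantsHypothesis := by
  obtain ⟨v, f, hpf, hf, hbar, hnc⟩ := h
  exact fun hEq => hnc (collapseEmptiesBoundaryOn_vnp hEq v f hpf hf hbar)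

/-! ### Comparison with the route's residual pair `(Q, U_CH)` -/

/-- **The route's pair implies the dichotomy's right-hand side outright**: `Q ∧ U_CH ⟹
(VNP ⊄ closure(VP)) ∨ M_CH` — `U_CH` charts ALL of the boundary, the dichotomy needs ONE charted
boundary point. [cite: Burgisser2026HNC, Def. 4.1-4.2 (p. 11)] -/
theorem borderValiant_or_chBoundaryPoint_of_Q_of_U (hQ : EmptyBoundarySeparates)
    (hU : CHClosureDefinable) : ¬ VNPSubsetVPBar ∨ BoundaryPointIn fun _ f => IsCHChartable f := by
  by_cases hA : BoundaryEmptyOn fun _ _ => True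
  · exact Or.inl (emptyBoundarySeparates_iff_on_univ.1 hQ hA)
  · rw [boundaryEmptyOn_iff_not_boundaryPointIn, not_not] at hA
    obtain ⟨v, f, hpf, -, hbar, hnc⟩ := hA
    exact Or.inr ⟨v, f, hpf, hU v f hpf hbar, hbar, hnc⟩

/-- **`U_CH` restricted to the boundary is what the route uses**: `Q_CH` follows from `Q` and the
chartability of BOUNDARY points only (`∀ f ∈ closure(VP) ∖ VP, f CH-chartable`).
[cite: Burgisser2026HNC, Def. 4.1-4.2 (p. 11)] -/
theorem emptyBoundarySeparatesOn_ch_of_Q_of_boundaryChartable (hQ : EmptyBoundarySeparates)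
    (hU : ∀ (v : ℕ → ℕ) (f : ∀ n, MvPolynomial (Fin (v n)) ℂ), IsPFamily f → IsVPBarFamily f →
      ¬ IsPComputable f → IsCHChartable f) :
    EmptyBoundarySeparatesOn fun _ f => IsCHChartable f := by
  intro hA
  refine emptyBoundarySeparates_iff_on_univ.1 hQ fun v f hpf _ hbar => ?_
  by_contra hnc
  exact hnc (hA v f hpf (hU v f hpf hbar hnc) hbar)

end Summit.ValiantsHypothesis.ValiantsHypothesis.Theorems.VPBoundarySquareBoundaryDichotomy
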